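import Mathlib
import Summits.Ventures.HodgeRepro2.T5RamifiedIntegralBasis
import Summits.Ventures.HodgeRepro2.T5NormCharConductor

/-!
# The break exponent of a ramified quadratic place: `i ≤ 2e + 1` and the two cases (T5RamifiedBreak)

Setting as T5RamifiedIntegralBasis: `K_v ⊆ L_w`, `[L_w : K_v] = 2`, `ϖ`, `π` uniformisers, the place ramified,
`σ ≠ 1`; `i ≥ 1` with `v(σ π − π) = exp(−i)` (the exponent `i_G(σ)`; break `t = i − 1`), `e` with `v(2) = exp(−e)`
in `K_v` (`e = v_K(2)`; `e = 0` iff the place is tame), `τ := π + σ π ∈ K_v` the trace of the uniformiser.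

* `σ π − π = alg τ − 2 π` with `v(2 π) = exp(−(2e + 1))` ODD and `v(alg τ)` a square or `0`: no cancellation, so
  `v(σ π − π) = max (v(alg τ)) (exp(−(2e + 1)))`. Hence **`i ≤ 2e + 1`** (Serre, Local Fields III §6 Prop. 13:
  `v_𝔭(𝔇) ≤ e − 1 + v_𝔭(e)` — here `𝔇 = (σ π − π) = (f'(π))`, `f = X² − τ X + N π` the Eisenstein polynomial of `π`),
  and the dichotomy **Case A**: `v(alg τ) = exp(−i)`, `i ≤ 2e` (`i` even) / **Case B**: `i = 2e + 1`,
  `v(alg τ) ≤ exp(−(2e + 2))`.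
* TAME (`2` a unit, `e = 0`): `i = 1`.
* The norm of `1 + alg c · z`: `(1 + alg c z)·σ(1 + alg c z) = alg (1 + c τ_z + c² ν_z)` for `z + σ z = alg τ_z`,
  `z σ z = alg ν_z` — the one-line identity behind the graded norm maps of the sequels.
-/

namespace Summit.Ventures.HodgeRepro2.T5RamifiedBreak

open IsDedekindDomain HeightOneSpectrum
open Summit.Ventures.HodgeRepro2.T5RamifiedIntegralBasis

variable {K : Type*} [Field K] [NumberField K] (v : HeightOneSpectrum (NumberField.RingOfIntegers K))
  {L : Type*} [Field L] [NumberField L] [Algebra K L] (w : HeightOneSpectrum (NumberField.RingOfIntegers L))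
  [w.asIdeal.LiesOver v.asIdeal]

noncomputable section

/-! ### `v(2)` in `K_v` -/

omit [Algebra K L] [w.asIdeal.LiesOver v.asIdeal] in
/-- `v(2) ≤ 1` in `K_v` (ultrametric: `2 = 1 + 1`). -/
theorem val_two_le_one : Valued.v (2 : v.adicCompletion K) ≤ 1 := by
  have : (2 : v.adicCompletion K) = 1 + 1 := by norm_num
  rw [this]
  calc Valued.v ((1 : v.adicCompletion K) + 1) ≤ max (Valued.v (1 : v.adicCompletion K)) (Valued.v 1) :=
        Valuation.map_add _ _ _
    _ = 1 := by rw [map_one, max_self]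

omit [Algebra K L] [w.asIdeal.LiesOver v.asIdeal] in
/-- `v(2) = exp(−e)` for a unique `e : ℕ` (`K_v` has characteristic zero). -/
theorem exists_val_two_eq : ∃ e : ℕ, Valued.v (2 : v.adicCompletion K) = WithZero.exp (-(e : ℤ)) := by
  haveI : CharZero (v.adicCompletion K) := T5NormCharConductor.charZero_adicCompletion v
  have h0 : Valued.v (2 : v.adicCompletion K) ≠ 0 := by
    rw [Valuation.ne_zero_iff]
    exact_mod_cast (by norm_num : (2 : ℕ) ≠ 0)
  have hle := val_two_le_one v
  set k := WithZero.log (Valued.v (2 : v.adicCompletion K)) with hk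
  have hvk : Valued.v (2 : v.adicCompletion K) = WithZero.exp k := (WithZero.exp_log h0).symm
  rw [hvk, ← WithZero.exp_zero, WithZero.exp_le_exp] at hle
  refine ⟨(-k).toNat, ?_⟩
  rw [hvk]
  congr 1
  omega

omit [Algebra K L] [w.asIdeal.LiesOver v.asIdeal] in
/-- TAME: `2` a unit of `O_{K_v}` ⇒ `v(2) = 1`, i.e. `e = 0`. -/
theorem val_two_eq_one_of_isUnit (h2u : IsUnit (2 : v.adicCompletionIntegers K)) :
    Valued.v (2 : v.adicCompletion K) = 1 := by
  obtain ⟨u, hu⟩ := h2u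
  have h1 : Valued.v ((u : v.adicCompletionIntegers K) : v.adicCompletion K) = 1 :=
    T5AdicCompletionNormSurjective.val_coe_units_eq_one v u
  rw [hu] at h1
  exact h1

/-- `σ π − π = alg τ − 2 π` where `alg τ = π + σ π`. -/
theorem algEquiv_sub_uniformizer_eq (σ : (w.adicCompletion L) ≃ₐ[v.adicCompletion K] (w.adicCompletion L))
    (π : w.adicCompletionIntegers L) {τ : v.adicCompletion K}
    (hτ : algebraMap (v.adicCompletion K) (w.adicCompletion L) τ = (π : w.adicCompletion L) + σ π) :
    σ (π : w.adicCompletion L) - π =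
      algebraMap (v.adicCompletion K) (w.adicCompletion L) τ - 2 * (π : w.adicCompletion L) := by
  rw [hτ]
  ring

section Ramified

variable [ContinuousSMul (v.adicCompletion K) (w.adicCompletion L)]

/-- `v(2 π) = exp(−(2e + 1))` in `L_w` (`v(alg 2) = v(2)² = exp(−2e)`, row 165). -/
theorem val_two_mul_uniformizer (h2 : Module.finrank (v.adicCompletion K) (w.adicCompletion L) = 2)
    {ϖ : v.adicCompletionIntegers K} (hϖ : Irreducible ϖ) {π : w.adicCompletionIntegers L} (hπ : Irreducible π)
    (hram : ¬ Irreducible (algebraMap (v.adicCompletionIntegers K) (w.adicCompletionIntegers L) ϖ))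
    (e : ℕ) (he : Valued.v (2 : v.adicCompletion K) = WithZero.exp (-(e : ℤ))) :
    Valued.v ((2 : w.adicCompletion L) * (π : w.adicCompletion L)) = WithZero.exp (-(2 * e + 1 : ℤ)) := by
  have h2alg : (2 : w.adicCompletion L) = algebraMap (v.adicCompletion K) (w.adicCompletion L) 2 := by
    rw [map_ofNat]
  rw [map_mul, h2alg, T5RamifiedNormTransfer.val_algebraMap_eq_sq v w h2 hϖ hπ hram, he,
    T5AdicCompletionNormGroup.val_uniformizer w hπ, ← WithZero.exp_nsmul, ← WithZero.exp_add]
  congr 1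
  rw [nsmul_eq_mul]
  push_cast
  ring

/-- `v(σ π − π) = max (v(alg τ)) (v(2 π))`: the two values have different parity (no cancellation). -/
theorem val_algEquiv_sub_uniformizer_eq_max
    (h2 : Module.finrank (v.adicCompletion K) (w.adicCompletion L) = 2)
    {ϖ : v.adicCompletionIntegers K} (hϖ : Irreducible ϖ) {π : w.adicCompletionIntegers L} (hπ : Irreducible π)
    (hram : ¬ Irreducible (algebraMap (v.adicCompletionIntegers K) (w.adicCompletionIntegers L) ϖ))
    (σ : (w.adicCompletion L) ≃ₐ[v.adicCompletion K] (w.adicCompletion L)) {τ : v.adicCompletion K}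
    (hτ : algebraMap (v.adicCompletion K) (w.adicCompletion L) τ = (π : w.adicCompletion L) + σ π)
    (e : ℕ) (he : Valued.v (2 : v.adicCompletion K) = WithZero.exp (-(e : ℤ))) :
    Valued.v (σ (π : w.adicCompletion L) - π) =
      max (Valued.v (algebraMap (v.adicCompletion K) (w.adicCompletion L) τ))
        (WithZero.exp (-(2 * e + 1 : ℤ))) := by
  rw [algEquiv_sub_uniformizer_eq v w σ π hτ, ← val_two_mul_uniformizer v w h2 hϖ hπ hram e he]
  have h2' : (2 : w.adicCompletion L) * (π : w.adicCompletion L) =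
      algebraMap (v.adicCompletion K) (w.adicCompletion L) 2 * (π : w.adicCompletion L) := by
    rw [map_ofNat]
  rw [sub_eq_add_neg, ← Valuation.map_neg _ (2 * (π : w.adicCompletion L))]
  by_cases hτ0 : τ = 0
  · subst hτ0
    simp
  rw [h2', ← neg_mul, ← map_neg]
  apply Valuation.map_add_of_distinct_val
  exact val_algebraMap_ne_val_algebraMap_mul_uniformizer v w h2 hϖ hπ hram hτ0 (by norm_num)

/-- THE BOUND `i ≤ 2e + 1`. -/
theorem break_le_two_mul_add_one (h2 : Module.finrank (v.adicCompletion K) (w.adicCompletion L) = 2)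
    {ϖ : v.adicCompletionIntegers K} (hϖ : Irreducible ϖ) {π : w.adicCompletionIntegers L} (hπ : Irreducible π)
    (hram : ¬ Irreducible (algebraMap (v.adicCompletionIntegers K) (w.adicCompletionIntegers L) ϖ))
    (σ : (w.adicCompletion L) ≃ₐ[v.adicCompletion K] (w.adicCompletion L)) (hσ : σ ≠ 1)
    {i : ℕ} (hi : Valued.v (σ (π : w.adicCompletion L) - π) = WithZero.exp (-(i : ℤ)))
    (e : ℕ) (he : Valued.v (2 : v.adicCompletion K) = WithZero.exp (-(e : ℤ))) :
    i ≤ 2 * e + 1 := by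
  obtain ⟨τ, hτ⟩ := exists_algebraMap_eq_add_algEquiv v w h2 σ hσ (π : w.adicCompletion L)
  have hmax := val_algEquiv_sub_uniformizer_eq_max v w h2 hϖ hπ hram σ hτ e he
  rw [hi] at hmax
  have : WithZero.exp (-(2 * e + 1 : ℤ)) ≤ WithZero.exp (-(i : ℤ)) := by
    rw [hmax]
    exact le_max_right _ _
  rw [WithZero.exp_le_exp] at this
  omega

/-- THE DICHOTOMY. Case A: `v(alg τ) = exp(−i)` and `i ≤ 2e`; Case B: `i = 2e + 1` and `v(alg τ) ≤ exp(−(2e + 2))`. -/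
theorem break_cases (h2 : Module.finrank (v.adicCompletion K) (w.adicCompletion L) = 2)
    {ϖ : v.adicCompletionIntegers K} (hϖ : Irreducible ϖ) {π : w.adicCompletionIntegers L} (hπ : Irreducible π)
    (hram : ¬ Irreducible (algebraMap (v.adicCompletionIntegers K) (w.adicCompletionIntegers L) ϖ))
    (σ : (w.adicCompletion L) ≃ₐ[v.adicCompletion K] (w.adicCompletion L)) {τ : v.adicCompletion K}
    (hτ : algebraMap (v.adicCompletion K) (w.adicCompletion L) τ = (π : w.adicCompletion L) + σ π)
    {i : ℕ} (hi : Valued.v (σ (π : w.adicCompletion L) - π) = WithZero.exp (-(i : ℤ)))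
    (e : ℕ) (he : Valued.v (2 : v.adicCompletion K) = WithZero.exp (-(e : ℤ))) :
    (Valued.v (algebraMap (v.adicCompletion K) (w.adicCompletion L) τ) = WithZero.exp (-(i : ℤ)) ∧
        i ≤ 2 * e) ∨
      (i = 2 * e + 1 ∧
        Valued.v (algebraMap (v.adicCompletion K) (w.adicCompletion L) τ) ≤ WithZero.exp (-(2 * e + 2 : ℤ))) := by
  have hmax := val_algEquiv_sub_uniformizer_eq_max v w h2 hϖ hπ hram σ hτ e he
  rw [hi] at hmax
  rcases le_or_gt (Valued.v (algebraMap (v.adicCompletion K) (w.adicCompletion L) τ))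
      (WithZero.exp (-(2 * e + 1 : ℤ))) with hle | hlt
  · -- Case B
    right
    rw [max_eq_right hle] at hmax
    have hi' : i = 2 * e + 1 := by
      have := WithZero.exp_injective hmax
      omega
    refine ⟨hi', ?_⟩
    by_cases hτ0 : τ = 0
    · subst hτ0
      simp
    rw [val_algebraMap_eq_exp_two_mul_log v w h2 hϖ hπ hram hτ0] at hle ⊢
    rw [WithZero.exp_le_exp] at hle ⊢
    omega
  · -- Case A
    left
    rw [max_eq_left hlt.le] at hmax
    refine ⟨hmax.symm, ?_⟩
    rw [← hmax, WithZero.exp_lt_exp] at hlt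
    omega

/-- TAME: `2` a unit ⇒ `i = 1`. -/
theorem break_eq_one_of_isUnit_two (h2 : Module.finrank (v.adicCompletion K) (w.adicCompletion L) = 2)
    {ϖ : v.adicCompletionIntegers K} (hϖ : Irreducible ϖ) {π : w.adicCompletionIntegers L} (hπ : Irreducible π)
    (hram : ¬ Irreducible (algebraMap (v.adicCompletionIntegers K) (w.adicCompletionIntegers L) ϖ))
    (σ : (w.adicCompletion L) ≃ₐ[v.adicCompletion K] (w.adicCompletion L)) (hσ : σ ≠ 1)
    {i : ℕ} (hi1 : 1 ≤ i) (hi : Valued.v (σ (π : w.adicCompletion L) - π) = WithZero.exp (-(i : ℤ)))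
    (h2u : IsUnit (2 : v.adicCompletionIntegers K)) : i = 1 := by
  have he : Valued.v (2 : v.adicCompletion K) = WithZero.exp (-((0 : ℕ) : ℤ)) := by
    rw [val_two_eq_one_of_isUnit v h2u]
    simp
  have := break_le_two_mul_add_one v w h2 hϖ hπ hram σ hσ hi 0 he
  omega

end Ramified

/-! ### The norm of `1 + alg c · z` -/

/-- `(1 + alg c z) · σ(1 + alg c z) = alg (1 + c τ + c² ν)` when `z + σ z = alg τ`, `z σ z = alg ν`. -/
theorem one_add_mul_mul_algEquiv
    (σ : (w.adicCompletion L) ≃ₐ[v.adicCompletion K] (w.adicCompletion L))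
    (c : v.adicCompletion K) (z : w.adicCompletion L) {τ ν : v.adicCompletion K}
    (hτ : algebraMap (v.adicCompletion K) (w.adicCompletion L) τ = z + σ z)
    (hν : algebraMap (v.adicCompletion K) (w.adicCompletion L) ν = z * σ z) :
    (1 + algebraMap (v.adicCompletion K) (w.adicCompletion L) c * z) *
        σ (1 + algebraMap (v.adicCompletion K) (w.adicCompletion L) c * z) =
      algebraMap (v.adicCompletion K) (w.adicCompletion L) (1 + c * τ + c ^ 2 * ν) := by
  simp only [map_add, map_mul, map_one, map_pow, AlgEquiv.commutes]
  rw [hτ, hν]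
  ring

/-- The unit `1 + c τ + c² ν` of `K_v` lies in the norm group (witness `1 + alg c z`). -/
theorem mem_normGroup_of_eq (σ : (w.adicCompletion L) ≃ₐ[v.adicCompletion K] (w.adicCompletion L))
    (c : v.adicCompletion K) (z : w.adicCompletion L) {τ ν : v.adicCompletion K}
    (hτ : algebraMap (v.adicCompletion K) (w.adicCompletion L) τ = z + σ z)
    (hν : algebraMap (v.adicCompletion K) (w.adicCompletion L) ν = z * σ z)
    (y : (v.adicCompletion K)ˣ) (hy : (y : v.adicCompletion K) = 1 + c * τ + c ^ 2 * ν) :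
    y ∈ T5AdicCompletionNormGroup.normGroup v w σ := by
  rw [T5AdicCompletionNormGroup.mem_normGroup_iff]
  exact ⟨1 + algebraMap (v.adicCompletion K) (w.adicCompletion L) c * z, by
    rw [one_add_mul_mul_algEquiv v w σ c z hτ hν, hy]⟩

end

end Summit.Ventures.HodgeRepro2.T5RamifiedBreak
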